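import Summits.NavierStokesRegularity.NavierStokesRegularity.Theses.FlatSwirlGauge
import Literature.Analysis.FluidPDE.NSLerayHopfSereginEnergyProofs
import Literature.Analysis.FluidPDE.KatoFarFieldBound
import Literature.Analysis.FluidPDE.RusinSverakLeraySolutions
import Literature.Analysis.FluidPDE.KatoMaximalTimeSingular
import Literature.Analysis.FluidPDE.NSCriticalClosureTao
import Literature.Analysis.FluidPDE.TaoClassGlue

/-!
# Route FlatSwirlGauge — `LocalBoundedExtends` (item stmt-NavierStokesRegularity-1255)

The local-to-global continuation support of route FlatSwirlGauge:

  for `ν > 0`, `T > 0` and a classical solution `(u, p)` of the unforced Navier–Stokes system on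
  `ℝ³ × [0, T)` which is Leray–Hopf on `[0, T]` from its rapidly decaying datum `u 0`, if every
  point `x₀ ∈ ℝ³` has a backward cylinder `(T - r², T) × B_r(x₀)` (times `t ≥ 0`) on which `u` is
  bounded, then `u` extends as a classical solution past `T` (`HasSmoothExtensionPast ν 0 u T`).

## Proof (bookkeeping over engines proved in the tree)

No far-field estimate is run here: the localisation of a first blow-up at a *finite point* is
already inside the tree's singular-point theorem for the maximal Kato solution
(`lemarieRieusset_singular_point_of_blowup_holds`, Lemarié-Rieusset 2016, Thm. 15.1 (C)), so the
argument is the Kato maximal-time dichotomy of `TypeICertificateLadderNoBlowupToClay.lean`.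

Let `u₀ = u 0` (smooth, divergence free, rapidly decaying, hence in `L² ∩ L³` and weakly
divergence free) and `T_max = katoMaximalTime ν u₀ > 0` (`katoMaximalTime_pos`,
`kato_local_holds`).

* **Tao-class solutions from `u₀` are `u`.** A Tao-class solution `(v, q)` on `[0, τ]` from `u₀`
  (`IsTaoSolutionOn`: classical on the closed slab with bounded Sobolev norms) is bounded and
  Leray–Hopf, so Prodi–Serrin weak–strong uniqueness against the Leray–Hopf solution `u`
  (`eq_restart_of_serrin` with the proved `serrin_weak_strong_uniqueness_holds`, restart time
  `0`) gives `v t = u t` for `0 ≤ t < min τ T` (continuous slices agreeing a.e. agree).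
* **`T < T_max`.** Some Kato solution lives on `[0, T')`, `T < T'`
  (`exists_isKatoSolutionOn_of_lt_katoMaximalTime`); along it there is a Tao-class solution on
  `[0, τ]`, `τ = (T + T')/2` (`exists_isTaoSolutionOn_of_isKatoSolutionOn`, von Wahl / Kato:
  `C_t L³` is a regularity class). It is classical on `[0, τ)` and agrees with `u` on `[0, T)`:
  the extension.
* **`T_max ≤ T` is impossible.** Then `S = T_max` is finite, the maximal Kato solution `w` on
  `[0, S)` exists (`exists_isKatoSolutionOn_katoMaximalTime`, `kato_unique_holds`) and has a
  singular point `(S, x₁)`: `w` is essentially unbounded on every `Q_r(S, x₁)`. For `0 < t < S`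
  the Tao-class solution on `[0, (t + S)/2]` equals `u` at `t` (first bullet) and equals `w t`
  a.e. (`IsTaoSolutionOn.ae_eq_of_kato`), so `u = w` a.e. on the strip `(0, S) × ℝ³`
  (`ae_restrict_prod_of_forall_ae_eq`) and the singularity transfers to `u`
  (`eLpNorm_parabolicCylinder_eq_top_of_ae_eq`). But `u` is bounded on a small cylinder
  `Q_r(S, x₁)`: for `S < T` by continuity of `u` on the compact `[S/2, S] × B̄(x₁, 1) ⊆ [0, T) × ℝ³`,
  and for `S = T` by the hypothesis at `x₁` — contradiction.

## References

* P. G. Lemarié-Rieusset, *The Navier–Stokes Problem in the 21st Century*, CRC 2016, Thm. 7.2,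
  Prop. 12.3, Thm. 15.1 (C).
* J. C. Robinson, J. L. Rodrigo, W. Sadowski, *The Three-Dimensional Navier–Stokes Equations*,
  CUP 2016, Thm. 8.19 (weak–strong uniqueness).
* T. Kato, Math. Z. 187 (1984), Thms. 1, 4.
* L. Caffarelli, R. Kohn, L. Nirenberg, Comm. Pure Appl. Math. 35 (1982) (ε-regularity, inside
  the singular-point theorem).
-/

noncomputable section

open Literature.Analysis.FluidPDE MeasureTheory Set Function Filter Topology Metric
open scoped ENNReal NNReal

namespace Summit.NavierStokesRegularity.NavierStokesRegularity.Theorems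

/-- **`LocalBoundedExtends`** (item stmt-NavierStokesRegularity-1255, support of route
FlatSwirlGauge): for `ν > 0`, `T > 0` and a classical solution `(u, p)` of the unforced
Navier–Stokes system on `ℝ³ × [0, T)`, Leray–Hopf on `[0, T]` from its rapidly decaying datum
`u 0`, if every `x₀ ∈ ℝ³` has a backward cylinder `(T - r², T) × B_r(x₀)` (times `t ≥ 0`) on which
`u` is bounded, then `u` extends as a classical solution past `T`. Proof: Kato maximal-time
dichotomy — if `T < T_max(u 0)` a Tao-class solution on `[0, τ]`, `τ > T`, built along a Kato
solution (`exists_isTaoSolutionOn_of_isKatoSolutionOn`) agrees with `u` on `[0, T)` by Prodi–Serrin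
(`eq_restart_of_serrin`) and is the extension; if `T_max ≤ T` the maximal Kato solution has a
singular point `(T_max, x₁)` (`lemarieRieusset_singular_point_of_blowup_holds`), which transfers
to `u` (`u =` Kato solution a.e. below `T_max`), whereas `u` is bounded near `(T_max, x₁)` — by
continuity if `T_max < T`, by the hypothesis if `T_max = T`. See the module docstring. -/
theorem flatSwirlGauge_localBoundedExtends_proof :
    Summit.NavierStokesRegularity.NavierStokesRegularity.Theses.FlatSwirlGauge.LocalBoundedExtends :=
  by
  intro ν T hν hT u p hcl hLH hdec hloc
  classical
  /- ### the datum `u 0`: smooth, divergence free, rapidly decaying, `L²`, `L³` -/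
  have h0T : (0 : ℝ) ∈ Ico 0 T := ⟨le_rfl, hT⟩
  have hsm := hcl.contDiff_velocity h0T
  have hdiv : NSWave0.IsDivFree (u 0) := fun x => hcl.divFree 0 h0T x
  have hu2 : MemLp (u 0) 2 volume := hLH.memLp 0 ⟨le_rfl, hT.le⟩
  have hwdiv : IsWeaklyDivFree (u 0) := hLH.isWeaklyDivFree_datum hT
  have hmeas0 : AEStronglyMeasurable (u 0) volume := hsm.continuous.aestronglyMeasurable
  obtain ⟨C₀, hC₀⟩ := hdec 0 0
  have hbd0 : ∀ x, ‖u 0 x‖ ≤ C₀ := fun x => by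
    have h := hC₀ x
    rwa [pow_zero, one_mul, norm_iteratedFDeriv_zero] at h
  have hu3 : MemLp (u 0) 3 volume := by
    refine ⟨hmeas0, ?_⟩
    have h3 : eLpNorm (u 0) 3 volume ^ 3 ≤ eLpNorm (u 0) ⊤ volume * eLpNorm (u 0) 2 volume ^ 2 :=
      eLpNorm_three_pow_le hmeas0
    have htop : eLpNorm (u 0) ⊤ volume ≤ ENNReal.ofReal C₀ := eLpNorm_top_le_of_bound hbd0
    have hfin : eLpNorm (u 0) ⊤ volume * eLpNorm (u 0) 2 volume ^ 2 < ⊤ :=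
      ENNReal.mul_lt_top (htop.trans_lt ENNReal.ofReal_lt_top)
        (ENNReal.pow_lt_top hu2.eLpNorm_lt_top)
    by_contra hnot
    rw [not_lt, top_le_iff] at hnot
    rw [hnot, ENNReal.top_pow (by norm_num)] at h3
    exact absurd (h3.trans_lt hfin) (lt_irrefl _)
  /- ### Tao-class solutions from `u 0` coincide with `u` (Prodi–Serrin) -/
  have hLH0 : IsLerayHopfOn (T - 0) ν 0 (u 0) (fun t => u (t + 0)) := by simpa using hLH
  have hTao_eq : ∀ {τ : ℝ}, 0 < τ →
      ∀ {v : ℝ → EuclideanSpace ℝ (Fin 3) → EuclideanSpace ℝ (Fin 3)}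
        {q : ℝ → EuclideanSpace ℝ (Fin 3) → ℝ}, IsTaoSolutionOn τ ν (u 0) v q →
        ∀ t ∈ Ico 0 (min τ T), v t = u t := by
    intro τ hτ v q hv t ht
    have heq := eq_restart_of_serrin serrin_weak_strong_uniqueness_holds hν hτ le_rfl hT hcl hLH0
      hv.classical hv.initial hv.sobolev hv.sobolev_p hv.continuousL2
    have ht' : t ∈ Ico 0 (min τ (T - 0)) := by rwa [sub_zero]
    simpa using (heq t ht').symm
  /- ### Case `T < T_max(u 0)`: a Tao-class solution on `[0, τ]`, `τ > T`, extends `u` -/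
  by_cases hlt : ENNReal.ofReal T < katoMaximalTime ν (u 0)
  · obtain ⟨T', hTT', w, hw⟩ := exists_isKatoSolutionOn_of_lt_katoMaximalTime hlt
    have hTT'r : T < T' := (ENNReal.ofReal_lt_ofReal_iff'.1 hTT').1
    set τ : ℝ := (T + T') / 2 with hτ_def
    have hTτ : T < τ := by rw [hτ_def]; linarith
    have hτT' : τ < T' := by rw [hτ_def]; linarith
    have hτ0 : 0 < τ := hT.trans hTτ
    obtain ⟨v, q, hv⟩ := exists_isTaoSolutionOn_of_isKatoSolutionOn hν hsm hdiv hdec hw hτ0 hτT'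
    refine ⟨τ, hTτ, v, q, hv.classical.mono Ico_subset_Icc_self (uniqueDiffOn_Ico 0 τ), ?_⟩
    intro t ht
    exact hTao_eq hτ0 hv t ⟨ht.1, lt_min (ht.2.trans hTτ) ht.2⟩
  /- ### Case `T_max(u 0) ≤ T`: impossible -/
  exfalso
  rw [not_lt] at hlt
  have hTm0 : 0 < katoMaximalTime ν (u 0) := katoMaximalTime_pos kato_local_holds hν hu3 hwdiv
  have htop' : katoMaximalTime ν (u 0) < ⊤ := hlt.trans_lt ENNReal.ofReal_lt_top
  -- the maximal Kato solution `w` on `[0, S)`, `S = T_max ≤ T`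
  obtain ⟨w, hw⟩ := exists_isKatoSolutionOn_katoMaximalTime kato_unique_holds hν hTm0 htop'
  set S : ℝ := (katoMaximalTime ν (u 0)).toReal with hS_def
  have hS0 : 0 < S := ENNReal.toReal_pos hTm0.ne' htop'.ne
  have hofReal : ENNReal.ofReal S = katoMaximalTime ν (u 0) := ENNReal.ofReal_toReal htop'.ne
  have hST : S ≤ T := by
    have h := ENNReal.toReal_mono ENNReal.ofReal_ne_top hlt
    rwa [ENNReal.toReal_ofReal hT.le] at h
  have hmax : ∀ T'' : ℝ, S < T'' → ∀ w' : ℝ → EuclideanSpace ℝ (Fin 3) → EuclideanSpace ℝ (Fin 3),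
      ¬ IsKatoSolutionOn T'' ν (u 0) w' :=
    fun T'' hT'' w' => not_isKatoSolutionOn_of_katoMaximalTime_lt (by
      rw [← hofReal]
      exact (ENNReal.ofReal_lt_ofReal_iff (hS0.trans hT'')).2 hT'')
  -- its singular point `(S, x₁)`
  obtain ⟨x₁, hx₁⟩ := lemarieRieusset_singular_point_of_blowup_holds hν hS0 hu3 hwdiv hw hmax
  have hall : ∀ r : ℝ, 0 < r →
      eLpNorm (uncurry w) ⊤ (volume.restrict (parabolicCylinder r ((S : ℝ), x₁))) = ⊤ :=
    fun r hr => eLpNorm_top_parabolicCylinder_eq_top_of_small hS0 hx₁ hr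
  -- `u = w` a.e. on every slice of `(0, S)`, through the Tao-class solutions
  have huw : ∀ t ∈ Ioo 0 S, u t =ᵐ[volume] w t := by
    intro t ht
    set τ : ℝ := (t + S) / 2 with hτ_def
    have htτ : t < τ := by rw [hτ_def]; linarith [ht.2]
    have hτS : τ < S := by rw [hτ_def]; linarith [ht.2]
    have hτ0 : 0 < τ := ht.1.trans htτ
    obtain ⟨v, q, hv⟩ := exists_isTaoSolutionOn_of_isKatoSolutionOn hν hsm hdiv hdec hw hτ0 hτS
    have hwτ : IsKatoSolutionOn τ ν (u 0) w := hw.mono hτS.le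
    have h1 : v t =ᵐ[volume] w t :=
      hv.ae_eq_of_kato hν hwτ.mild hwτ.continuousInLpOn hwτ.aestronglyMeasurable t ⟨ht.1.le, htτ⟩
    have h2 : v t = u t := hTao_eq hτ0 hv t ⟨ht.1.le, lt_min htτ (ht.2.trans_le hST)⟩
    rw [← h2]
    exact h1
  have hUm : AEStronglyMeasurable (uncurry u) (volume.restrict (Ioo 0 S ×ˢ univ)) :=
    (hcl.smooth_velocity.continuousOn.mono
      (prod_mono (fun t ht => ⟨ht.1.le, ht.2.trans_le hST⟩) Subset.rfl)).aestronglyMeasurable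
      (measurableSet_Ioo.prod MeasurableSet.univ)
  have huw' : uncurry u =ᵐ[volume.restrict (Ioo 0 S ×ˢ (univ : Set (EuclideanSpace ℝ (Fin 3))))]
      uncurry w :=
    ae_restrict_prod_of_forall_ae_eq huw hUm hw.aestronglyMeasurable
  -- `u` is bounded on a small cylinder `Q_r(S, x₁)`
  obtain ⟨r, hr0, K, hK⟩ : ∃ r : ℝ, 0 < r ∧ ∃ K : ℝ,
      ∀ z ∈ parabolicCylinder r ((S : ℝ), x₁), ‖uncurry u z‖ ≤ K := by
    rcases lt_or_eq_of_le hST with hlt' | heq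
    · -- `S < T`: continuity on the compact `[S/2, S] × B̄(x₁, 1) ⊆ [0, T) × ℝ³`
      set Kc : Set (ℝ × EuclideanSpace ℝ (Fin 3)) := Icc (S / 2) S ×ˢ closedBall x₁ 1 with hKc_def
      have hKc : IsCompact Kc := isCompact_Icc.prod (isCompact_closedBall _ _)
      have hKsub : Kc ⊆ Ico 0 T ×ˢ (univ : Set (EuclideanSpace ℝ (Fin 3))) :=
        prod_mono (fun t ht => ⟨by linarith [ht.1], ht.2.trans_lt hlt'⟩) (subset_univ _)
      have hcont : ContinuousOn (uncurry u) Kc := hcl.smooth_velocity.continuousOn.mono hKsub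
      obtain ⟨M, hM⟩ := hKc.exists_bound_of_continuousOn hcont
      set r : ℝ := min 1 (Real.sqrt (S / 2)) with hr_def
      have hr0 : 0 < r := lt_min one_pos (Real.sqrt_pos.2 (by positivity))
      have hr1 : r ≤ 1 := min_le_left _ _
      have hr2 : r ^ 2 ≤ S / 2 := by
        calc r ^ 2 ≤ Real.sqrt (S / 2) ^ 2 := pow_le_pow_left₀ hr0.le (min_le_right _ _) 2
          _ = S / 2 := Real.sq_sqrt (by positivity)
      refine ⟨r, hr0, M, fun z hz => hM z ?_⟩
      obtain ⟨s, y⟩ := z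
      simp only [mem_parabolicCylinder] at hz
      exact ⟨⟨by linarith [hz.1.1], hz.1.2.le⟩, mem_closedBall.2 (hz.2.le.trans hr1)⟩
    · -- `S = T`: the hypothesis at `x₁`
      obtain ⟨r₁, hr₁, K₁, hK₁⟩ := hloc x₁
      set r : ℝ := min r₁ (Real.sqrt T) with hr_def
      have hr0 : 0 < r := lt_min hr₁ (Real.sqrt_pos.2 hT)
      have hrr₁ : r ≤ r₁ := min_le_left _ _
      have hr2 : r ^ 2 ≤ T := by
        calc r ^ 2 ≤ Real.sqrt T ^ 2 := pow_le_pow_left₀ hr0.le (min_le_right _ _) 2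
          _ = T := Real.sq_sqrt hT.le
      have h2 : r ^ 2 ≤ r₁ ^ 2 := pow_le_pow_left₀ hr0.le hrr₁ 2
      refine ⟨r, hr0, K₁, fun z hz => ?_⟩
      obtain ⟨s, y⟩ := z
      simp only [mem_parabolicCylinder] at hz
      exact hK₁ s ⟨by linarith [hz.1.1], by linarith [hz.1.2]⟩ (by linarith [hz.1.1]) y
        (mem_ball.2 (hz.2.trans_le hrr₁))
  -- hence essentially bounded there …
  have hbdU : eLpNorm (uncurry u) ⊤ (volume.restrict (parabolicCylinder r ((S : ℝ), x₁))) < ⊤ := by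
    rw [eLpNorm_exponent_top]
    refine eLpNormEssSup_lt_top_of_ae_bound (C := K) ?_
    filter_upwards [ae_restrict_mem (isOpen_parabolicCylinder r ((S : ℝ), x₁)).measurableSet]
      with z hz
    exact hK z hz
  -- … contradicting the singularity of `w` at `(S, x₁)`, transferred to `u`
  exact hbdU.ne (eLpNorm_parabolicCylinder_eq_top_of_ae_eq hS0 huw' x₁ hall hr0)

end Summit.NavierStokesRegularity.NavierStokesRegularity.Theorems

end
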